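import Literature.NumberTheory.EllipticCurves.PAdicOneVariableSeriesFamilyMomentsOfCharacter
import Literature.NumberTheory.EllipticCurves.ProfiniteGroupDistributionGlueIntegral
import HarnessLib

/-!
# `p = 2`, ABSTRACT TOWERS, ABSTRACT SERIES: de Shalit II.4.12 at ALL moduli + II.4.14 Step 1 (GLUE) for additive
# `[κ]`-equivariant families of `𝐃`-series — the two-variable measure `E` on the diagonal tower with
# `δ_{σ_𝔠,N𝔠} E = i_n(β_n 𝔠)` and its moments `∫ κ^{k+1} dE` in terms of the Coleman logarithmic derivatives

Topic `NumberTheory/EllipticCurves`; namespace `Literature.NumberTheory.EllipticCurves`.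

De Shalit, *Iwasawa theory of elliptic curves with complex multiplication* (1987), II.4.14 Step 1 (p. 71):
"Consider the measures `μ(𝔤𝔭̄^m)` … they are compatible, so their inverse limit is a measure on `𝒢`", each
`μ(𝔣_m)` being the measure of II.4.12 (`μ_𝔞/δ_𝔞 = μ`).  This is the COMPOSABILITY CERTIFICATE of the whole
measure-side chain: `ProfiniteGroupDistributionTwoVariableAssembly.exists_glue_twisting_μ_eq_forall_of_units` fed,
at every modulus `m`, with `i_m := induce D_m` of an additive `[κ]`-equivariant series family
`φ_m : B_m → 𝒪̂_{F^nr}⟦X⟧` along the tower `𝒰^{(m)}` (`PAdicOneVariableSeriesFamilyOfCharacter.lean`), and the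
integrals of the glued measure computed by `integral_eq_of_glue` + `integral_glue_eq`
(`ProfiniteGroupDistributionGlueIntegral.lean`) + the coset formula
(`PAdicOneVariableSeriesFamilyMomentsOfCharacter.lean`):

* ★★★ `exists_glue_twisting_μ_eq_forall_seriesFamily` — **∃ E along the diagonal tower `V_n = U^{(n)}_n`, `‖E‖ = C`,
  with `δ_{σ_𝔠,N𝔠} E = i_n(β_n 𝔠)` at every level `n`, for EVERY `𝔠`** (all hypotheses displayed: cells per
  modulus, `hadd`/`hgal` per modulus, units with II.2.4 (ii), division hypotheses per modulus, common bound,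
  compatibility of the `μ_{𝔠₀}^{(m)}` for one `𝔠₀` with `N𝔠₀ ≥ 2`);
* ★★★ `integral_character_pow_succ_of_twisting_eq_glue_seriesFamily` — for such an `E`, every `𝔠` whose
  `μ_𝔠^{(m)} = i_m(β_m 𝔠)` are compatible, every modulus `m` and every `k` with `κ(σ_𝔠)^{k+1} ≠ N𝔠`:
  **`∫_G κ^{k+1} dE = (κ(σ_𝔠)^{k+1} − N𝔠)⁻¹ · Σ_{c ∈ G/U^{(m)}_0} κ(r_c)^{k+1} · [S^0] D^k H^{(m)}_{r_c⁻¹ • β_m 𝔠}`**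
  (the `(k+1)`-st moment of the two-variable measure read at ANY modulus — II.4.14 (36) reduced to the numbers
  `δ̃_{k+1}`).

Everything is proved; no named facts, no definitions, no instances (section-local instance attributes as in the
siblings), no `sorry`.

## References

* [deShalit1987] E. de Shalit, *Iwasawa theory of elliptic curves with complex multiplication* (1987),
  II.4.12 (p. 66–69), II.4.14 Step 1 (p. 71), II.4.7 (16)–(17) (p. 60), II.4.6 (14) (p. 59).
-/

noncomputable section

open MvPowerSeries Filter
open scoped Topology Classical

namespace Literature.NumberTheory.EllipticCurves

section SeriesFamilyGlue

open ValuativeRel IsLocalRing Field GroupDistribution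
open Literature.NumberTheory.GaloisRepresentations Literature.NumberTheory.GaloisRepresentations.IsNonarchimedeanLocalField
  Literature.NumberTheory.GaloisRepresentations.LubinTate Literature.NumberTheory.PAdicHodge

variable {F : Type} [Field F] [ValuativeRel F] [TopologicalSpace F] [IsNonarchimedeanLocalField F]

attribute [local instance] ltNormUniformSpace ltNormIsUniformAddGroup rk1 nF nE fintypeResidueField

variable (hq : residueFieldCard F = 2) (h2 : (valuation F).IsUniformizer (((2 : ℕ) : 𝒪[F]) : F))
  {σ₀ : absoluteGaloisGroup F} (hσ₀ : IsAbsArithFrob σ₀) (u : 𝒪[F]ˣ)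
  {ε : (maxUnramifiedCompletion F)ˣ}
  (hε : maxUnramifiedCompletion.galAut F σ₀ (ε : maxUnramifiedCompletion F) =
    algebraMap 𝒪[F] (maxUnramifiedCompletion F) (u : 𝒪[F]) * (ε : maxUnramifiedCompletion F))
  (Θ : UnrCoeff F →+* ℂ_[2]) (e : 𝒪[F] →+* ℤ_[2])
  (hΘe : ∀ a : 𝒪[F], Θ (intToUnrCoeff F a) = padicIntCast ℂ_[2] (e a))
variable {G : Type*} [Group G] {𝒰 : ℕ → SubgroupTower G} {href : ∀ m n, (𝒰 (m + 1)).U n ≤ (𝒰 m).U n}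
  [∀ m n, ((𝒰 m).U n).Normal] (κ : G →* ℤ_[2]ˣ)
  (hU : ∀ (m n : ℕ) (g : G), g ∈ (𝒰 m).U n ↔ g ∈ (𝒰 m).U 0 ∧ PadicInt.toZModPow (n + 1) (κ g : ℤ_[2]) = 1)
  (hκ : ∀ (m n : ℕ) (w : ℤ_[2]ˣ), PadicInt.toZModPow 1 (w : ℤ_[2]) = 1 →
    ∃ g ∈ (𝒰 m).U 0, PadicInt.toZModPow (n + 1) (κ g : ℤ_[2]) = PadicInt.toZModPow (n + 1) (w : ℤ_[2]))
  (ψ : (m n : ℕ) → G ⧸ (𝒰 m).U n → ZMod (2 ^ (n + 1)))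
  (hψ : ∀ (m n : ℕ) (g : G), g ∈ (𝒰 m).U 0 → ψ m n ((𝒰 m).proj n g) = PadicInt.toZModPow (n + 1) (κ g : ℤ_[2]))
variable {B : ℕ → Type*} [∀ m, CommMonoid (B m)] [∀ m, MulDistribMulAction G (B m)]
  (φ : (m : ℕ) → B m → PowerSeries (UnrCoeff F))
  (hadd : ∀ (m : ℕ) (b b' : B m), φ m (b * b') = φ m b + φ m b')
  (hgal : ∀ (m : ℕ), ∀ g ∈ (𝒰 m).U 0, ∀ b : B m, ∃ a : 𝒪[F], (κ g : ℤ_[2]) = e a ∧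
    φ m (g • b) = PowerSeries.C (intToUnrCoeff F a) * PowerSeries.subst (homC' h2 u a) (φ m b))
  {C : ℝ} (hC : ∀ (m : ℕ) (b : B m) (k : ℕ), ‖PowerSeries.coeff k ((PowerSeries.subst (compSeriesC h2 hσ₀ u hε) (φ m b)).map Θ)‖ ≤ C)
  (hsock : ∀ (m : ℕ) (b : B m) (k : ℕ), (restrictUnits ((invAmice₁ 2 ((PowerSeries.subst (compSeriesC h2 hσ₀ u hε) (φ m b)).map Θ) (hC m b)).density
          (ProfiniteTower.padicInt_isUniform 2) (unitInv ℂ_[2]) uniformContinuous_unitInv norm_unitInv_le)).integral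
      (fun x : ℤ_[2] ↦ padicIntCast ℂ_[2] (x ^ (k + 1))) = PowerSeries.constantCoeff (mahlerD^[k] ((PowerSeries.subst (compSeriesC h2 hσ₀ u hε) (φ m b)).map Θ)))
  (hC0 : 0 ≤ C) (hCb : ∀ (m : ℕ) (b : B m), (GroupDistribution.comap (restrictUnits ((invAmice₁ 2 ((PowerSeries.subst (compSeriesC h2 hσ₀ u hε) (φ m b)).map Θ) (hC m b)).density
          (ProfiniteTower.padicInt_isUniform 2) (unitInv ℂ_[2]) uniformContinuous_unitInv norm_unitInv_le))
          (ψ m) ((𝒰 m).cellMap_trans κ (ψ m) (hψ m)) ((𝒰 m).cellMap_injective κ (hU m) (ψ m) (hψ m))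
          ((𝒰 m).cellMap_fiberSurj κ (hU m) (hκ m) (ψ m) (hψ m))).bound ≤ C)
variable {I : Type*} (hcomm : ∀ (m n : ℕ) (x y : G), x * y * x⁻¹ * y⁻¹ ∈ (𝒰 m).U n)
  (β : (m : ℕ) → I → B m) (σ : I → G) (Nm : I → ℕ)
  (hrel : ∀ (m : ℕ) (a c : I), σ c • β m a * β m c ^ Nm a = σ a • β m c * β m a ^ Nm c)

include hq hΘe hadd hgal hcomm hrel in
/-- ★★★ **De Shalit II.4.12 at all moduli, glued (II.4.14 Step 1), for series families along abstract towers**: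
**∃ E along the diagonal tower, `‖E‖ = C`, with `δ_{σ_𝔠,N𝔠} E = i_n(β_n 𝔠)` at every level `n` for every `𝔠`**,
`i_m := induce D_m` the measure of II.4.6 of the `m`-th family.
[cite: deShalit1987, II.4.12 (p. 66–69), II.4.14 Step 1 (p. 71), II.4.6 (14) (p. 59)] -/
theorem exists_glue_twisting_μ_eq_forall_seriesFamily (s : ℕ → ℕ) (a₁ a₂ : ℕ → I)
    (hσ₁ : ∀ m, σ (a₁ m) ∈ (𝒰 m).U (s m)) (hσ₂ : ∀ m, σ (a₂ m) ∈ (𝒰 m).U (s m))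
    (hgen : ∀ m k, s m ≤ k → ∀ w ∈ (𝒰 m).U (s m), ∃ r : ℕ, (𝒰 m).proj k (σ (a₁ m) ^ r) = (𝒰 m).proj k w)
    (hpow : ∀ m n, s m ≤ n → ∃ r : ℕ, orderOf ((𝒰 m).proj n (σ (a₁ m))) = 2 ^ r)
    (hunb : ∀ m (r : ℕ), ∃ k, 2 ^ r ∣ orderOf ((𝒰 m).proj k (σ (a₁ m))))
    (hN1 : ∀ m, 2 ≤ Nm (a₁ m)) (h4 : ∀ m, 4 ∣ Nm (a₁ m) - 1) (hN12 : ∀ m, Nm (a₂ m) = Nm (a₁ m))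
    (hτ : ∀ m k, 0 < k → ∃ n, s m ≤ n ∧ σ (a₂ m) ^ k * (σ (a₁ m) ^ k)⁻¹ ∉ (𝒰 m).U n)
    (c₀ : I) (hNc₀ : 2 ≤ Nm c₀)
    (hcompat : ∀ (m n : ℕ) (a : G ⧸ (𝒰 m).U n),
      ((GroupDistribution.induce (fun b ↦ (GroupDistribution.comap (restrictUnits ((invAmice₁ 2 ((PowerSeries.subst (compSeriesC h2 hσ₀ u hε) (φ (m + 1) b)).map Θ) (hC (m + 1) b)).density
          (ProfiniteTower.padicInt_isUniform 2) (unitInv ℂ_[2]) uniformContinuous_unitInv norm_unitInv_le))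
          (ψ (m + 1)) ((𝒰 (m + 1)).cellMap_trans κ (ψ (m + 1)) (hψ (m + 1))) ((𝒰 (m + 1)).cellMap_injective κ (hU (m + 1)) (ψ (m + 1)) (hψ (m + 1)))
          ((𝒰 (m + 1)).cellMap_fiberSurj κ (hU (m + 1)) (hκ (m + 1)) (ψ (m + 1)) (hψ (m + 1))))) hC0 (hCb (m + 1)) (β (m + 1) c₀)).pushforward (MonoidHom.id G)
        (SubgroupTower.le_comap_id 𝒰 href m)).μ n a = (GroupDistribution.induce (fun b ↦ (GroupDistribution.comap (restrictUnits ((invAmice₁ 2 ((PowerSeries.subst (compSeriesC h2 hσ₀ u hε) (φ m b)).map Θ) (hC m b)).density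
          (ProfiniteTower.padicInt_isUniform 2) (unitInv ℂ_[2]) uniformContinuous_unitInv norm_unitInv_le))
          (ψ m) ((𝒰 m).cellMap_trans κ (ψ m) (hψ m)) ((𝒰 m).cellMap_injective κ (hU m) (ψ m) (hψ m))
          ((𝒰 m).cellMap_fiberSurj κ (hU m) (hκ m) (ψ m) (hψ m)))) hC0 (hCb m) (β m c₀)).μ n a) :
    ∃ E : GroupDistribution (SubgroupTower.diagonal 𝒰 href) ℂ_[2], E.bound = C ∧
      ∀ (c : I) (n : ℕ) (b : G ⧸ (𝒰 n).U n),
        (twisting (σ c) (Nm c : ℂ_[2]) E).μ n b = (GroupDistribution.induce (fun b ↦ (GroupDistribution.comap (restrictUnits ((invAmice₁ 2 ((PowerSeries.subst (compSeriesC h2 hσ₀ u hε) (φ n b)).map Θ) (hC n b)).density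
          (ProfiniteTower.padicInt_isUniform 2) (unitInv ℂ_[2]) uniformContinuous_unitInv norm_unitInv_le))
          (ψ n) ((𝒰 n).cellMap_trans κ (ψ n) (hψ n)) ((𝒰 n).cellMap_injective κ (hU n) (ψ n) (hψ n))
          ((𝒰 n).cellMap_fiberSurj κ (hU n) (hκ n) (ψ n) (hψ n)))) hC0 (hCb n) (β n c)).μ n b :=
  exists_glue_twisting_μ_eq_forall_of_units (p := 2) (href := href) hcomm
    (fun m b ↦ (GroupDistribution.induce (fun b ↦ (GroupDistribution.comap (restrictUnits ((invAmice₁ 2 ((PowerSeries.subst (compSeriesC h2 hσ₀ u hε) (φ m b)).map Θ) (hC m b)).density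
          (ProfiniteTower.padicInt_isUniform 2) (unitInv ℂ_[2]) uniformContinuous_unitInv norm_unitInv_le))
          (ψ m) ((𝒰 m).cellMap_trans κ (ψ m) (hψ m)) ((𝒰 m).cellMap_injective κ (hU m) (ψ m) (hψ m))
          ((𝒰 m).cellMap_fiberSurj κ (hU m) (hκ m) (ψ m) (hψ m)))) hC0 (hCb m) b))
    (fun m g b n a ↦ induce_μ_smul_inv_seriesFamily hq h2 hσ₀ u hε Θ e hΘe κ (hU m) (hκ m) (ψ m) (hψ m) (φ m)
      (hgal m) (hC m) hC0 (hCb m) g b n a)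
    (fun m b b' n a ↦ induce_μ_mul_seriesFamily h2 hσ₀ u hε Θ κ (hU m) (hκ m) (ψ m) (hψ m) (φ m) (hadd m) (hC m) hC0
      (hCb m) b b' n a)
    β σ Nm hrel s a₁ a₂ hσ₁ hσ₂ hgen hpow hunb hN1 (fun m ↦ dvd_trans ⟨2, rfl⟩ (h4 m)) (fun m _ ↦ h4 m) hN12 hτ
    hC0 (fun _ ↦ le_rfl) c₀ hNc₀ hcompat

include hsock in
/-- ★★★ **The moments of the glued (two-variable) measure at any modulus** (II.4.14 Step 1 with (29)↔(31) and
(16)–(17)): if `δ_{σ_𝔠,N𝔠} E = i_n(β_n 𝔠)` at every level and the `μ_𝔠^{(m)} = i_m(β_m 𝔠)` are compatible under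
coarsening, then for every modulus `m` and every `k` with `κ(σ_𝔠)^{k+1} ≠ N𝔠`:
**`∫_G κ(g)^{k+1} dE(g) = (κ(σ_𝔠)^{k+1} − N𝔠)⁻¹ · Σ_{c ∈ G/U^{(m)}_0} κ(r_c)^{k+1} · [S^0] D^k H^{(m)}_{r_c⁻¹ • β_m 𝔠}`**.
[cite: deShalit1987, II.4.14 Step 1 (p. 71), II.4.12 (29)–(31) (p. 67–69), II.4.7 (16)–(17) (p. 60)] -/
theorem integral_character_pow_succ_of_twisting_eq_glue_seriesFamily
    (E : GroupDistribution (SubgroupTower.diagonal 𝒰 href) ℂ_[2]) (c : I)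
    (hE : ∀ (n : ℕ) (b : G ⧸ (𝒰 n).U n),
      (twisting (σ c) (Nm c : ℂ_[2]) E).μ n b = (GroupDistribution.induce (fun b ↦ (GroupDistribution.comap (restrictUnits ((invAmice₁ 2 ((PowerSeries.subst (compSeriesC h2 hσ₀ u hε) (φ n b)).map Θ) (hC n b)).density
          (ProfiniteTower.padicInt_isUniform 2) (unitInv ℂ_[2]) uniformContinuous_unitInv norm_unitInv_le))
          (ψ n) ((𝒰 n).cellMap_trans κ (ψ n) (hψ n)) ((𝒰 n).cellMap_injective κ (hU n) (ψ n) (hψ n))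
          ((𝒰 n).cellMap_fiberSurj κ (hU n) (hκ n) (ψ n) (hψ n)))) hC0 (hCb n) (β n c)).μ n b)
    (hcompat : ∀ (m n : ℕ) (a : G ⧸ (𝒰 m).U n),
      ((GroupDistribution.induce (fun b ↦ (GroupDistribution.comap (restrictUnits ((invAmice₁ 2 ((PowerSeries.subst (compSeriesC h2 hσ₀ u hε) (φ (m + 1) b)).map Θ) (hC (m + 1) b)).density
          (ProfiniteTower.padicInt_isUniform 2) (unitInv ℂ_[2]) uniformContinuous_unitInv norm_unitInv_le))
          (ψ (m + 1)) ((𝒰 (m + 1)).cellMap_trans κ (ψ (m + 1)) (hψ (m + 1))) ((𝒰 (m + 1)).cellMap_injective κ (hU (m + 1)) (ψ (m + 1)) (hψ (m + 1)))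
          ((𝒰 (m + 1)).cellMap_fiberSurj κ (hU (m + 1)) (hκ (m + 1)) (ψ (m + 1)) (hψ (m + 1))))) hC0 (hCb (m + 1)) (β (m + 1) c)).pushforward (MonoidHom.id G)
        (SubgroupTower.le_comap_id 𝒰 href m)).μ n a = (GroupDistribution.induce (fun b ↦ (GroupDistribution.comap (restrictUnits ((invAmice₁ 2 ((PowerSeries.subst (compSeriesC h2 hσ₀ u hε) (φ m b)).map Θ) (hC m b)).density
          (ProfiniteTower.padicInt_isUniform 2) (unitInv ℂ_[2]) uniformContinuous_unitInv norm_unitInv_le))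
          (ψ m) ((𝒰 m).cellMap_trans κ (ψ m) (hψ m)) ((𝒰 m).cellMap_injective κ (hU m) (ψ m) (hψ m))
          ((𝒰 m).cellMap_fiberSurj κ (hU m) (hκ m) (ψ m) (hψ m)))) hC0 (hCb m) (β m c)).μ n a)
    (m k : ℕ) (hne : padicIntCast ℂ_[2] ((κ (σ c) : ℤ_[2]) ^ (k + 1)) ≠ (Nm c : ℂ_[2])) :
    E.integral (fun g ↦ padicIntCast ℂ_[2] ((κ g : ℤ_[2]) ^ (k + 1))) =
      (padicIntCast ℂ_[2] ((κ (σ c) : ℤ_[2]) ^ (k + 1)) - (Nm c : ℂ_[2]))⁻¹ *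
        ∑ c' ∈ (𝒰 m).cells 0, padicIntCast ℂ_[2] ((κ ((𝒰 m).repr 0 c') : ℤ_[2]) ^ (k + 1)) *
          PowerSeries.constantCoeff (mahlerD^[k] ((PowerSeries.subst (compSeriesC h2 hσ₀ u hε) (φ m (((𝒰 m).repr 0 c')⁻¹ • β m c))).map Θ)) := by
  have hχm : (𝒰 m).IsTowerContinuous (fun g ↦ padicIntCast ℂ_[2] ((κ g : ℤ_[2]) ^ (k + 1))) :=
    SubgroupTower.isTowerContinuous_padicIntCast_character_pow κ (hU m) (k + 1)
  rw [integral_eq_of_glue (p := 2) (href := href) (fun m b ↦ (GroupDistribution.induce (fun b ↦ (GroupDistribution.comap (restrictUnits ((invAmice₁ 2 ((PowerSeries.subst (compSeriesC h2 hσ₀ u hε) (φ m b)).map Θ) (hC m b)).density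
          (ProfiniteTower.padicInt_isUniform 2) (unitInv ℂ_[2]) uniformContinuous_unitInv norm_unitInv_le))
          (ψ m) ((𝒰 m).cellMap_trans κ (ψ m) (hψ m)) ((𝒰 m).cellMap_injective κ (hU m) (ψ m) (hψ m))
          ((𝒰 m).cellMap_fiberSurj κ (hU m) (hκ m) (ψ m) (hψ m)))) hC0 (hCb m) b))
    β σ Nm E c hE hC0 (fun _ ↦ le_rfl) hcompat (SubgroupTower.IsTowerContinuous.diagonal_of href hχm)
    (fun x y ↦ by rw [map_mul, Units.val_mul, mul_pow, map_mul]) (by rw [map_one, Units.val_one, one_pow, map_one]) hne,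
    integral_glue_eq (href := href) _ hC0 (fun _ ↦ le_rfl) hcompat m hχm,
    integral_induce_character_pow_succ_seriesFamily h2 hσ₀ u hε Θ κ (hU m) (hκ m) (ψ m) (hψ m) (φ m) (hC m) (hsock m)
      hC0 (hCb m) (β m c) k]

end SeriesFamilyGlue

end Literature.NumberTheory.EllipticCurves

end
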